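import Literature.Probability.Percolation.MarkedLoopTripodCuts
import Literature.RepresentationTheory.Semisimple.CharpolySubquotient
import Mathlib.LinearAlgebra.Trace
import Mathlib.LinearAlgebra.Charpoly.ToMatrix
import Mathlib.LinearAlgebra.Basis.VectorSpace
import HarnessLib

/-!
# The character of the rotation on the tripod-law solution space: it vanishes off the identity when `3 ∤ k`

Topic `Literature/Probability/Percolation`; generic-`k` layer, sequel to `MarkedLoopTripodBasis.lean` («TRIPOD-SOLVED»: the solution space
`solW k` of Khristoforov–Smirnov's tripod law, `finrank_solW_add_card_pic`: `dim solW + #Pic = #Pat`), `MarkedLoopTripodRank.lean` (`Pic`: tripod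
pictures up to rotation = the independent relations), `MarkedLoopRotation.lean` (cyclic symmetries `IsCyc`, `rot k = finRotate k`, `patMap`,
`TripodPicture.map`) and `MarkedLoopTripodCuts.lean` (`mem_solW_iff_tripodLaw_classWt`, `comp_patMap_mem_solW`, `solWRot` — the rotation acts
linearly on `solW k`). QUESTION (the lane's door (G)): what is `solW k` as a `ℂ[Z/k]`-module? ANSWER here: for `k` coprime to `3` its character
vanishes off the identity — `tr (rot^r | solW k) = 0` for `k ∤ r` — so every `k`-th root of unity is an eigenvalue of the rotation with the SAME
multiplicity `#NCMatching(k+1)/k` (a FREE `ℂ[Z/k]`-module; the lane's exact tables: multiplicities 1, 2, 12, 33 for k = 5, 7, 11, 13; for 3 ∣ k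
the character is NOT zero at the two rotations of order 3 — k = 3: 1+τ, −τ; k = 9: 3+3τ, −3τ; k = 15: 10+10τ, −10τ — not treated here).

## Content
* `relMapΦ k : (Pat k → ℂ) →ₗ (Pic k → ℂ)` — THE RELATION MAP `w ↦ (w(lo P) + τ w(mid P) + τ² w(hi P))_P`; ★★ `ker_relMapΦ` (its kernel is
  `solW k`, via `mem_solW_iff_tripodLaw_classWt` and the three rotations of a tripod picture), ★ `relMapΦ_surjective` (onto, by rank–nullity with
  `finrank_solW_add_card_pic`) — the short exact sequence `0 → solW k → ℂ^{Pat k} → ℂ^{Pic k} → 0`.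
* `Pic.shift hσ P` / `Pic.shiftPhase hσ P` — the transported picture re-ordered increasingly (one of the three rotations of `(σα, σβ, σγ; σL₀)`)
  and its phase `1 / τ / τ²`; ★★ `relMapΦ_comp_patMap` — `Φ (w ∘ σ) P = phase(P) · Φ w (shift P)`: the relation map INTERTWINES the permutation
  action on patterns with a MONOMIAL action `picMonomial hσ` on pictures (`relMapΦ_comp_funLeft`); ★ `exists_fixed_of_shift_eq` (a fixed picture
  forces `σ³ x = x` for some corner), `exists_fixed_of_patMap_eq` (a fixed pattern forces `σ x = x`).
* `rot_pow_apply_eq_self_iff` (`rot^r x = x ↔ k ∣ r`), `rot_pow_three_apply`, ★ `rot_pow_cube_ne_self` (for `3 ∤ k`, `k ∤ r`: no fixed cube).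
* ★ `trace_eq_zero_of_monomial` — a monomial endomorphism of `ℂ^ι` without fixed points has trace `0` (diagonal of its matrix in the standard basis);
  trace additivity along a short exact sequence (private, from the tree's `LinearMap.charpoly_eq_mul_of_exact`, Bourbaki *Algèbre* VIII §20 n°6).
* ★★★ `trace_solWRot_pow_eq_zero` — **for `Nat.Coprime 3 k` and `k ∤ r`, `LinearMap.trace ℂ (solW k) (solWRot k (rot k ^ r)) = 0`**; `trace_solWRot_eq_zero`
  (`r = 1`, `k ≥ 2`); ★★ `trace_solWRot_pow_eq_neg_sum_fixed` — THE CHARACTER IN GENERAL (every `k`, `k ∤ r`):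
  `tr (rot^r | solW k) = −Σ_{P : shift P = P} phase(P)` (`trace_eq_sum_fixed_of_monomial`: the trace of a monomial map is the phase sum over its
  fixed points); for `3 ∣ k`, `r ∈ {k/3, 2k/3}` the fixed pictures are the rotation-invariant «triangles» (their count `(k/3)·C_{(k−3)/6}` and the
  resulting values `−(k/3)·C_{(k−3)/6}·τ^{±2}` are the lane's exact tables, not typed).
* § Divisibility — `rotOp k r` (the powers as endomorphisms of `solW k`), `patMap_mul` / `patMap_one` / `patMap_congr` / `rot_pow_self`, `rotOp_succ`,
  `rotOp_zero`, `avgOp = Σ_{r<k} R_r` with `rotOp_comp_avgOp` (`R ∘ A = A`), `avgOp_apply_of_fixed` (`A = k` on invariants), `avgOp_comp_avgOp`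
  (`A ∘ A = k·A`), `avgProj = k⁻¹·A` idempotent (`isIdempotentElem_avgProj`), `trace_avgOp = dim solW` (from the vanishing character), ★★
  `finrank_solW_eq_mul_finrank_fixed` (`dim solW k = k · dim (rotation-invariant solutions)`, via Mathlib `LinearMap.IsProj.trace`), ★★
  `dvd_card_ncMatching` — **`Nat.Coprime 3 k → 0 < k → k ∣ #NCMatching (k+1)`**: the number of non-crossing perfect matchings of `k+1` points is
  divisible by `k` whenever `3 ∤ k` — arithmetic read off the representation (consistent with the Catalan closed form, not used: for `k = 2n−1`,
  `gcd(2n−1, n+1) ∣ 3`; the hypothesis is sharp: `#NCMatching 4 = 2` is not divisible by `3`).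

* § Isotypic — `twAvgOp ζ = Σ_{r<k} ζ^{−r} R_r`, `twProj ζ = k⁻¹·A_ζ` (idempotent; `mem_range_twProj_iff`: its range IS the `ζ`-eigenspace of the rotation),
  `trace_twAvgOp = dim solW` (3 ∤ k), ★★★ `finrank_solW_eq_mul_finrank_eigenspace` — **FREENESS IN FULL: for `3 ∤ k`, `k ≥ 1` and EVERY `ζ` with
  `ζ^k = 1`, `dim solW k = k · dim {w : rot·w = ζ w}`** — every character of `Z/k` occurs in `solW k` with the same multiplicity `#NCMatching(k+1)/k`.
* § OrderThree (`k = 3r`) — `val_rot_pow_or`, ★ `shift_eq_self_iff_of_three_mul` (the pictures fixed by the re-ordered transport along `rot^r` are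
  EXACTLY the invariant triangles `(α, α+r, α+2r; L₀)` with `rot^r L₀ = L₀`), `shiftPhase_eq_of_fixed` (their phase is `τ²`), ★★ `trace_solWRot_third_eq` —
  **`tr (rot^{k/3} | solW k) = −τ² · #{invariant triangle pictures}`** (the lane's tables: the count is `(k/3)·C_{(k−3)/6}` = 1, 3, 10 for k = 3, 9, 15 —
  the Catalan count itself is not evaluated here).
* § Defect — `holoDefect D v` (the holomorphicity defect `Σ_i τ^i ObsW D (classWt w) v i` as a linear functional of `w`), `holoDefect_eq_zero_of_mem_solW`
  (HOLO-K), ★★ `holoDefect_factors` — AT EVERY FACE OF EVERY `k`-MARKED DOMAIN THE DEFECT OF ANY PATTERN WEIGHT IS A LINEAR FUNCTION OF ITS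
  TRIPOD-RELATION VALUES: `∃ λ, ∀ w, Σ_i τ^i ObsW D (classWt w) v i = λ (Φ w)` (the defect kills `ker Φ = solW` and `Φ` is onto; Mathlib `Submodule.liftQ`,
  `LinearMap.quotKerEquivOfSurjective`) — the tripod relations are the only linear source of holomorphicity; HOLO-K is the case `Φ w = 0`.

Not claimed: NECESSITY (joint injectivity of the functionals `λ_{D,v}` over all domains — the lane's door (E)), an explicit `ℂ[Z/k]`-module
isomorphism (the eigenspace dimensions are typed, a basis of eigenvectors is not), the NUMBER of invariant triangle pictures for `3 ∣ k` (a Catalan count)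
and the value at `rot^{2k/3}` (lane exact tables `gen15/rh/FINDING-ROTATION-CHARACTER.md`, k ≤ 15, incl. two blind predictions),
anything about observables or continuum limits.

## References
* M. Khristoforov, S. Smirnov, *Percolation and O(1) loop model*, arXiv:2111.15612 (2021), §1.2 (arXiv v1 p. 2: marked points «go in the
  counterclockwise order and are indexed cyclically»), §2 Definition 3 and Lemma 4 with its proof and Fig. 3 (p. 4: «each triple contributes zero»).
* B. Bollobás, O. Riordan, *Percolation*, CUP (2006), Ch. 7 §7.2.2 (pp. 191–195: marked discrete domains).
* N. Bourbaki, *Algèbre*, Ch. VIII §20 n°6 (traces along exact sequences) — through the tree's `Literature.RepresentationTheory.Semisimple.CharpolySubquotient`.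

## Mathlib / tree
Mathlib: `LinearMap.trace_eq_matrix_trace`, `LinearMap.toMatrix_apply`, `Pi.basisFun`, `Pi.single_apply`, `Matrix.trace_eq_neg_charpoly_nextCoeff`,
`LinearMap.charpoly_toMatrix`, `Polynomial.Monic.nextCoeff_mul`, `LinearMap.finrank_range_add_finrank_ker`, `Submodule.eq_top_of_finrank_eq`,
`LinearMap.funLeft`, `Nat.Coprime.dvd_mul_left`, `Nat.ModEq.add_left_cancel'`, `LinearMap.isProj_range_iff_isIdempotentElem`, `LinearMap.IsProj.trace`,
`LinearMap.trace_id`, `Module.Free.of_divisionRing`, `Submodule.liftQ`, `LinearMap.quotKerEquivOfSurjective`. Tree: `MarkedLoopTripodBasis` (`Pat`, `solW`, `classWt`,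
`finrank_solW_add_card_pic`, `TripodPicture.isPattern_lo`, `holomorphicW_classWt`, `obsWLin`, `classWtLin`), `MarkedLoopTripodRank` (`Pic`, `Pic.loPat/midPat/hiPat`, `Pic.pic/lt₁/lt₂`),
`MarkedLoopRotation` (`IsCyc`, `rot`, `isCyc_rot_pow`, `val_rot_pow`, `relMap`, `relMap_withPair`, `TripodPicture.map`), `MarkedLoopTripodCuts` (`patMap`,
`mem_solW_iff_tripodLaw_classWt`, `solWRot`), `MarkedLoopHolomorphy` (`TripodPicture`, `TripodPicture.rotate`, `TripodLaw`, `withPair`, `CcwTriple`),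
`Literature.RepresentationTheory.Semisimple.CharpolySubquotient` (`LinearMap.charpoly_eq_mul_of_exact`).
-/

open Finset

namespace Literature.Probability.Percolation.MarkedLoops

open Literature.Probability.Percolation.FivePoint (tau)
open Literature.RepresentationTheory.Semisimple

/-! ### The relation map `Φ : (Pat k → ℂ) → (Pic k → ℂ)` -/

section RelationMap

variable {nm : ℕ}

/-- `τ³ = 1`. [cite: KhristoforovSmirnov2021, §2 Definition 3 (arXiv v1 p. 4: `τ = e^{2πi/3}`)] -/
private theorem tau_cubed : tau ^ 3 = 1 := by
  unfold tau
  rw [← Complex.exp_nat_mul]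
  have : ((3 : ℕ) : ℂ) * (2 * Real.pi * Complex.I / 3) = 2 * Real.pi * Complex.I := by push_cast; ring
  rw [this, Complex.exp_two_pi_mul_I]

/-- the lo pattern of a picture, as a pattern. [cite: KhristoforovSmirnov2021, §2 Lemma 4, proof and Fig. 3 (arXiv v1 p. 4)] -/
noncomputable def Pic.loP (P : Pic nm) : Pat nm := ⟨P.loPat, P.pic.isPattern_lo⟩

/-- the mid pattern of a picture, as a pattern (the one-car's `Pic.toPat`). [cite: KhristoforovSmirnov2021, §2 Lemma 4, proof and Fig. 3 (arXiv v1 p. 4)] -/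
noncomputable def Pic.midP (P : Pic nm) : Pat nm := ⟨P.midPat, P.pic.rotate.isPattern_lo⟩

/-- the hi pattern of a picture, as a pattern. [cite: KhristoforovSmirnov2021, §2 Lemma 4, proof and Fig. 3 (arXiv v1 p. 4)] -/
noncomputable def Pic.hiP (P : Pic nm) : Pat nm := ⟨P.hiPat, P.pic.rotate.rotate.isPattern_lo⟩

variable (nm) in
/-- ★ **THE RELATION MAP**: a pattern weight `w` goes to the values `w(lo P) + τ·w(mid P) + τ²·w(hi P)` of the tripod relations, one per picture
(increasing representative). [cite: KhristoforovSmirnov2021, §2 Lemma 4, proof and Fig. 3 (arXiv v1 p. 4: «each triple contributes zero»)] -/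
noncomputable def relMapΦ : (Pat nm → ℂ) →ₗ[ℂ] (Pic nm → ℂ) where
  toFun w P := w P.loP + tau * w P.midP + tau ^ 2 * w P.hiP
  map_add' w w' := by funext P; simp only [Pi.add_apply]; ring
  map_smul' c w := by funext P; simp only [Pi.smul_apply, smul_eq_mul, RingHom.id_apply]; ring

/-- the relation map evaluated. [cite: KhristoforovSmirnov2021, §2 Lemma 4 (arXiv v1 p. 4)] -/
theorem relMapΦ_apply (w : Pat nm → ℂ) (P : Pic nm) : relMapΦ nm w P = w P.loP + tau * w P.midP + tau ^ 2 * w P.hiP := rfl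

/-- the class weight of `w` at the three raw patterns of a picture. [cite: KhristoforovSmirnov2021, §2 Definition 3 and Lemma 4 (arXiv v1 p. 4)] -/
private theorem classWt_pic (w : Pat nm → ℂ) {α β γ : Fin nm} {L₀ : Finset (Fin nm × Fin nm)} (h : TripodPicture α β γ L₀) :
    classWt w α (withPair L₀ β γ) = w ⟨(α, withPair L₀ β γ), h.isPattern_lo⟩ ∧
      classWt w β (withPair L₀ γ α) = w ⟨(β, withPair L₀ γ α), h.rotate.isPattern_lo⟩ ∧
      classWt w γ (withPair L₀ α β) = w ⟨(γ, withPair L₀ α β), h.rotate.rotate.isPattern_lo⟩ := by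
  unfold classWt
  rw [dif_pos h.isPattern_lo, dif_pos h.rotate.isPattern_lo, dif_pos h.rotate.rotate.isPattern_lo]
  exact ⟨rfl, rfl, rfl⟩

/-- ★★ **THE KERNEL OF THE RELATION MAP IS THE SOLUTION SPACE** `solW k`. [cite: KhristoforovSmirnov2021, §2 Lemma 4, proof and Fig. 3 (arXiv v1 p. 4)] -/
theorem ker_relMapΦ : LinearMap.ker (relMapΦ nm) = solW nm := by
  ext w
  rw [LinearMap.mem_ker, mem_solW_iff_tripodLaw_classWt]
  constructor
  · intro h α β γ L₀ hP
    obtain ⟨e1, e2, e3⟩ := classWt_pic w hP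
    rw [e1, e2, e3]
    rcases hP.ccw with ⟨h1, h2⟩ | ⟨h1, h2⟩ | ⟨h1, h2⟩
    · -- increasing: the picture itself
      have key := congrFun h ⟨((α, β, γ), L₀), h1, h2, hP⟩
      exact key
    · -- `β < γ < α`: the picture `(β, γ, α)`
      have key : relMapΦ nm w ⟨((β, γ, α), L₀), h1, h2, hP.rotate⟩ = 0 := by rw [h]; rfl
      rw [relMapΦ_apply] at key
      change w ⟨(β, withPair L₀ γ α), _⟩ + tau * w ⟨(γ, withPair L₀ α β), _⟩ + tau ^ 2 * w ⟨(α, withPair L₀ β γ), _⟩ = 0 at key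
      linear_combination tau * key - w ⟨(α, withPair L₀ β γ), hP.isPattern_lo⟩ * tau_cubed
    · -- `γ < α < β`: the picture `(γ, α, β)`
      have key : relMapΦ nm w ⟨((γ, α, β), L₀), h1, h2, hP.rotate.rotate⟩ = 0 := by rw [h]; rfl
      rw [relMapΦ_apply] at key
      change w ⟨(γ, withPair L₀ α β), _⟩ + tau * w ⟨(α, withPair L₀ β γ), _⟩ + tau ^ 2 * w ⟨(β, withPair L₀ γ α), _⟩ = 0 at key
      linear_combination tau ^ 2 * key -
        (w ⟨(α, withPair L₀ β γ), hP.isPattern_lo⟩ + tau * w ⟨(β, withPair L₀ γ α), hP.rotate.isPattern_lo⟩) * tau_cubed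
  · intro h
    funext P
    rw [Pi.zero_apply, relMapΦ_apply]
    have key := h P.α P.β P.γ P.L₀ P.pic
    obtain ⟨e1, e2, e3⟩ := classWt_pic w P.pic
    rw [e1, e2, e3] at key
    exact key

/-- ★ **THE RELATION MAP IS ONTO** (rank–nullity with `finrank_solW_add_card_pic`: the relations are independent).
[cite: KhristoforovSmirnov2021, §2 Lemma 4, proof and Fig. 3 (arXiv v1 p. 4)] -/
theorem relMapΦ_surjective : Function.Surjective (relMapΦ nm) := by
  have hrn := LinearMap.finrank_range_add_finrank_ker (relMapΦ nm)
  rw [ker_relMapΦ, Module.finrank_fintype_fun_eq_card] at hrn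
  have hdim := finrank_solW_add_card_pic nm
  have hr : Module.finrank ℂ (LinearMap.range (relMapΦ nm)) = Module.finrank ℂ (Pic nm → ℂ) := by
    rw [Module.finrank_fintype_fun_eq_card]; omega
  rw [← LinearMap.range_eq_top]
  exact Submodule.eq_top_of_finrank_eq hr

end RelationMap

/-! ### Transport of pictures along a cyclic symmetry: the increasing re-ordering and its phase -/

section PicTransport

variable {nm : ℕ} {σ : Equiv.Perm (Fin nm)}

/-- the transported triple of a picture is anticlockwise. [cite: KhristoforovSmirnov2021, §1.2 (arXiv v1 p. 2: cyclic indexing)] -/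
private theorem ccw_shift (hσ : IsCyc σ) (P : Pic nm) : CcwTriple (σ P.α) (σ P.β) (σ P.γ) := (hσ _ _ _).2 (Or.inl ⟨P.lt₁, P.lt₂⟩)

/-- trichotomy of the re-ordering. [cite: KhristoforovSmirnov2021, §1.2 (arXiv v1 p. 2)] -/
private theorem third_case (hσ : IsCyc σ) (P : Pic nm) (h1 : ¬ (σ P.α < σ P.β ∧ σ P.β < σ P.γ)) (h2 : ¬ (σ P.β < σ P.γ ∧ σ P.γ < σ P.α)) :
    σ P.γ < σ P.α ∧ σ P.α < σ P.β := by
  rcases ccw_shift hσ P with h | h | h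
  · exact absurd h h1
  · exact absurd h h2
  · exact h

/-- ★ **the transported picture, re-ordered increasingly** (one of the three rotations of `(σα, σβ, σγ; σL₀)`).
[cite: KhristoforovSmirnov2021, §2 Lemma 4, proof and Fig. 3 (arXiv v1 p. 4); §1.2 (p. 2)] -/
noncomputable def Pic.shift (hσ : IsCyc σ) (P : Pic nm) : Pic nm :=
  if h1 : σ P.α < σ P.β ∧ σ P.β < σ P.γ then ⟨((σ P.α, σ P.β, σ P.γ), relMap σ P.L₀), h1.1, h1.2, P.pic.map hσ⟩
  else if h2 : σ P.β < σ P.γ ∧ σ P.γ < σ P.α then ⟨((σ P.β, σ P.γ, σ P.α), relMap σ P.L₀), h2.1, h2.2, (P.pic.map hσ).rotate⟩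
  else ⟨((σ P.γ, σ P.α, σ P.β), relMap σ P.L₀), (third_case hσ P h1 h2).1, (third_case hσ P h1 h2).2, (P.pic.map hσ).rotate.rotate⟩

/-- the PHASE of the re-ordering: `1`, `τ`, `τ²` for the three cases (it depends on `σ` only; `hσ` is carried for uniformity).
[cite: KhristoforovSmirnov2021, §2 Lemma 4 (arXiv v1 p. 4)] -/
noncomputable def Pic.shiftPhase (_hσ : IsCyc σ) (P : Pic nm) : ℂ :=
  if σ P.α < σ P.β ∧ σ P.β < σ P.γ then 1 else if σ P.β < σ P.γ ∧ σ P.γ < σ P.α then tau else tau ^ 2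

/-- the transported patterns of a picture, at the raw level. [cite: KhristoforovSmirnov2021, §1.2 (arXiv v1 p. 2)] -/
private theorem patMap_loP (hσ : IsCyc σ) (P : Pic nm) : patMap σ hσ P.loP = ⟨(σ P.α, withPair (relMap σ P.L₀) (σ P.β) (σ P.γ)), (P.pic.map hσ).isPattern_lo⟩ :=
  Subtype.ext (Prod.ext rfl (relMap_withPair σ _ _ _))

/-- Auxiliary. [cite: KhristoforovSmirnov2021, §1.2 (arXiv v1 p. 2)] -/
private theorem patMap_midP (hσ : IsCyc σ) (P : Pic nm) :
    patMap σ hσ P.midP = ⟨(σ P.β, withPair (relMap σ P.L₀) (σ P.γ) (σ P.α)), (P.pic.map hσ).rotate.isPattern_lo⟩ :=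
  Subtype.ext (Prod.ext rfl (relMap_withPair σ _ _ _))

/-- Auxiliary. [cite: KhristoforovSmirnov2021, §1.2 (arXiv v1 p. 2)] -/
private theorem patMap_hiP (hσ : IsCyc σ) (P : Pic nm) :
    patMap σ hσ P.hiP = ⟨(σ P.γ, withPair (relMap σ P.L₀) (σ P.α) (σ P.β)), (P.pic.map hσ).rotate.rotate.isPattern_lo⟩ :=
  Subtype.ext (Prod.ext rfl (relMap_withPair σ _ _ _))

/-- ★★ **THE RELATION MAP INTERTWINES THE ROTATION OF PATTERNS WITH A MONOMIAL MAP ON PICTURES**: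
`Φ (w ∘ σ) P = phase(P) · Φ w (shift P)`. [cite: KhristoforovSmirnov2021, §2 Lemma 4, proof and Fig. 3 (arXiv v1 p. 4); §1.2 (p. 2: cyclic indexing)] -/
theorem relMapΦ_comp_patMap (hσ : IsCyc σ) (w : Pat nm → ℂ) (P : Pic nm) :
    relMapΦ nm (w ∘ patMap σ hσ) P = Pic.shiftPhase hσ P * relMapΦ nm w (Pic.shift hσ P) := by
  rw [relMapΦ_apply, relMapΦ_apply, Function.comp_apply, Function.comp_apply, Function.comp_apply, patMap_loP hσ, patMap_midP hσ,
    patMap_hiP hσ]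
  unfold Pic.shift Pic.shiftPhase
  by_cases h1 : σ P.α < σ P.β ∧ σ P.β < σ P.γ
  · rw [dif_pos h1, if_pos h1, one_mul]
    rfl
  · rw [dif_neg h1, if_neg h1]
    by_cases h2 : σ P.β < σ P.γ ∧ σ P.γ < σ P.α
    · rw [dif_pos h2, if_pos h2]
      change _ = tau * (w ⟨(σ P.β, withPair (relMap σ P.L₀) (σ P.γ) (σ P.α)), _⟩ + tau * w ⟨(σ P.γ, withPair (relMap σ P.L₀) (σ P.α) (σ P.β)), _⟩ +
        tau ^ 2 * w ⟨(σ P.α, withPair (relMap σ P.L₀) (σ P.β) (σ P.γ)), _⟩)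
      linear_combination (-(w ⟨(σ P.α, withPair (relMap σ P.L₀) (σ P.β) (σ P.γ)), (P.pic.map hσ).isPattern_lo⟩)) * tau_cubed
    · rw [dif_neg h2, if_neg h2]
      change _ = tau ^ 2 * (w ⟨(σ P.γ, withPair (relMap σ P.L₀) (σ P.α) (σ P.β)), _⟩ + tau * w ⟨(σ P.α, withPair (relMap σ P.L₀) (σ P.β) (σ P.γ)), _⟩ +
        tau ^ 2 * w ⟨(σ P.β, withPair (relMap σ P.L₀) (σ P.γ) (σ P.α)), _⟩)
      linear_combination (-(w ⟨(σ P.α, withPair (relMap σ P.L₀) (σ P.β) (σ P.γ)), (P.pic.map hσ).isPattern_lo⟩) -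
        tau * w ⟨(σ P.β, withPair (relMap σ P.L₀) (σ P.γ) (σ P.α)), (P.pic.map hσ).rotate.isPattern_lo⟩) * tau_cubed

/-- ★ **a fixed picture forces a fixed point of `σ³`**: if `shift P = P` then `σ (σ (σ x)) = x` for some corner `x`.
[cite: KhristoforovSmirnov2021, §1.2 (arXiv v1 p. 2: cyclic indexing)] -/
theorem exists_fixed_of_shift_eq (hσ : IsCyc σ) (P : Pic nm) (h : Pic.shift hσ P = P) : ∃ x : Fin nm, σ (σ (σ x)) = x := by
  unfold Pic.shift at h
  by_cases h1 : σ P.α < σ P.β ∧ σ P.β < σ P.γ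
  · rw [dif_pos h1] at h
    have e : σ P.α = P.α := congrArg Pic.α h
    exact ⟨P.α, by rw [e, e, e]⟩
  · rw [dif_neg h1] at h
    by_cases h2 : σ P.β < σ P.γ ∧ σ P.γ < σ P.α
    · rw [dif_pos h2] at h
      have e1 : σ P.β = P.α := congrArg Pic.α h
      have e2 : σ P.γ = P.β := congrArg Pic.β h
      have e3 : σ P.α = P.γ := congrArg Pic.γ h
      exact ⟨P.α, by rw [e3, e2, e1]⟩
    · rw [dif_neg h2] at h
      have e1 : σ P.γ = P.α := congrArg Pic.α h
      have e2 : σ P.α = P.β := congrArg Pic.β h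
      have e3 : σ P.β = P.γ := congrArg Pic.γ h
      exact ⟨P.α, by rw [e2, e3, e1]⟩

/-- a fixed pattern forces a fixed point of `σ` (the partner). [cite: KhristoforovSmirnov2021, §1.2 (arXiv v1 p. 2)] -/
theorem exists_fixed_of_patMap_eq (hσ : IsCyc σ) (p : Pat nm) (h : patMap σ hσ p = p) : ∃ x : Fin nm, σ x = x :=
  ⟨p.1.1, congrArg (fun q : Pat nm => q.1.1) h⟩

end PicTransport

/-! ### Rotations: no fixed points unless `k ∣ r`, no fixed cubes unless `k ∣ 3r` -/

section RotFixed

variable {nm : ℕ}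

/-- `rot^r x = x` iff `k ∣ r`. [cite: KhristoforovSmirnov2021, §1.2 (arXiv v1 p. 2: cyclic indexing)] -/
theorem rot_pow_apply_eq_self_iff (r : ℕ) (x : Fin nm) : (rot nm ^ r) x = x ↔ nm ∣ r := by
  rw [Fin.ext_iff, val_rot_pow]
  have hx := x.2
  constructor
  · intro h
    have h1 : (x.val + r) % nm = (x.val + 0) % nm := by rw [h, Nat.add_zero, Nat.mod_eq_of_lt hx]
    have h2 := Nat.ModEq.add_left_cancel' x.val h1
    exact (Nat.modEq_zero_iff_dvd.1 h2)
  · rintro ⟨c, rfl⟩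
    rw [Nat.add_mul_mod_self_left, Nat.mod_eq_of_lt hx]

/-- three steps of `rot^r` are `rot^(3r)`. [cite: KhristoforovSmirnov2021, §1.2 (arXiv v1 p. 2)] -/
theorem rot_pow_three_apply (r : ℕ) (x : Fin nm) : (rot nm ^ r) ((rot nm ^ r) ((rot nm ^ r) x)) = (rot nm ^ (3 * r)) x := by
  rw [show 3 * r = r + r + r by ring, pow_add, pow_add, Equiv.Perm.mul_apply, Equiv.Perm.mul_apply]

/-- ★ for `3 ∤ k` and `k ∤ r`, `rot^r` has no fixed cube. [cite: KhristoforovSmirnov2021, §1.2 (arXiv v1 p. 2)] -/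
theorem rot_pow_cube_ne_self (h3 : Nat.Coprime 3 nm) {r : ℕ} (hr : ¬ nm ∣ r) (x : Fin nm) :
    (rot nm ^ r) ((rot nm ^ r) ((rot nm ^ r) x)) ≠ x := by
  rw [rot_pow_three_apply, Ne, rot_pow_apply_eq_self_iff]
  intro h
  exact hr ((Nat.Coprime.dvd_mul_left h3.symm).1 h)

end RotFixed

/-! ### Traces: monomial maps without fixed points have trace zero; trace additivity along `0 → solW → ℂ^Pat → ℂ^Pic → 0` -/

section Traces

/-- **a MONOMIAL endomorphism without fixed points has trace zero**: if `(T v) i = c i · v (e i)` with `e i ≠ i` for all `i`, then `tr T = 0`.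
[cite: KhristoforovSmirnov2021, §1.2 (arXiv v1 p. 2: cyclic indexing)] -/
theorem trace_eq_zero_of_monomial {ι : Type*} [Fintype ι] [DecidableEq ι] (e : ι → ι) (c : ι → ℂ) (he : ∀ i, e i ≠ i)
    (T : (ι → ℂ) →ₗ[ℂ] (ι → ℂ)) (hT : ∀ v i, T v i = c i * v (e i)) : LinearMap.trace ℂ (ι → ℂ) T = 0 := by
  rw [LinearMap.trace_eq_matrix_trace ℂ (Pi.basisFun ℂ ι) T, Matrix.trace]
  refine Finset.sum_eq_zero fun i _ => ?_
  rw [Matrix.diag_apply, LinearMap.toMatrix_apply, Pi.basisFun_repr, Pi.basisFun_apply, hT, Pi.single_apply, if_neg (he i), mul_zero]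

/-- **the trace of a monomial endomorphism is the sum of its phases over the FIXED points**: if `(T v) i = c i · v (e i)` then
`tr T = Σ_{i : e i = i} c i`. [cite: KhristoforovSmirnov2021, §1.2 (arXiv v1 p. 2: cyclic indexing)] -/
theorem trace_eq_sum_fixed_of_monomial {ι : Type*} [Fintype ι] [DecidableEq ι] (e : ι → ι) (c : ι → ℂ)
    (T : (ι → ℂ) →ₗ[ℂ] (ι → ℂ)) (hT : ∀ v i, T v i = c i * v (e i)) :
    LinearMap.trace ℂ (ι → ℂ) T = ∑ i ∈ Finset.univ.filter (fun i => e i = i), c i := by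
  rw [LinearMap.trace_eq_matrix_trace ℂ (Pi.basisFun ℂ ι) T, Matrix.trace, Finset.sum_filter]
  refine Finset.sum_congr rfl fun i _ => ?_
  rw [Matrix.diag_apply, LinearMap.toMatrix_apply, Pi.basisFun_repr, Pi.basisFun_apply, hT, Pi.single_apply]
  split_ifs <;> simp

/-- `tr g = −nextCoeff (charpoly g)` (Mathlib's `Matrix.trace_eq_neg_charpoly_nextCoeff` in a basis). [cite: KhristoforovSmirnov2021, §2 Lemma 4 (arXiv v1 p. 4)] -/
private theorem trace_eq_neg_nextCoeff_charpoly' {W : Type*} [AddCommGroup W] [Module ℂ W] [FiniteDimensional ℂ W] (g : W →ₗ[ℂ] W) :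
    LinearMap.trace ℂ W g = -g.charpoly.nextCoeff := by
  classical
  rw [LinearMap.trace_eq_matrix_trace ℂ (Module.finBasis ℂ _) g, Matrix.trace_eq_neg_charpoly_nextCoeff, LinearMap.charpoly_toMatrix]

/-- trace additivity along a short exact sequence with compatible endomorphisms (Bourbaki, *Algèbre* VIII §20 n°6; via the tree's
`LinearMap.charpoly_eq_mul_of_exact`). [cite: KhristoforovSmirnov2021, §2 Lemma 4 (arXiv v1 p. 4)] -/
private theorem trace_eq_add_of_exact' {V S' Q' : Type*} [AddCommGroup V] [Module ℂ V] [FiniteDimensional ℂ V] [AddCommGroup S'] [Module ℂ S']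
    [FiniteDimensional ℂ S'] [AddCommGroup Q'] [Module ℂ Q'] [FiniteDimensional ℂ Q']
    (f : V →ₗ[ℂ] V) (i : S' →ₗ[ℂ] V) (π : V →ₗ[ℂ] Q') (hi : Function.Injective i)
    (hπ : Function.Surjective π) (hex : LinearMap.range i = LinearMap.ker π)
    (fS : S' →ₗ[ℂ] S') (fQ : Q' →ₗ[ℂ] Q') (hS : i ∘ₗ fS = f ∘ₗ i) (hQ : π ∘ₗ f = fQ ∘ₗ π) :
    LinearMap.trace ℂ V f = LinearMap.trace ℂ S' fS + LinearMap.trace ℂ Q' fQ := by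
  rw [trace_eq_neg_nextCoeff_charpoly' f, trace_eq_neg_nextCoeff_charpoly' fS, trace_eq_neg_nextCoeff_charpoly' fQ,
    LinearMap.charpoly_eq_mul_of_exact f i π hi hπ hex fS fQ hS hQ,
    Polynomial.Monic.nextCoeff_mul (LinearMap.charpoly_monic _) (LinearMap.charpoly_monic _), neg_add]

end Traces

/-! ### The theorem: the rotation acts on the solution space with vanishing character (free over `Z/k`) when `3 ∤ k` -/

section Character

variable {nm : ℕ}

/-- the monomial map on `ℂ^Pic` induced by a cyclic symmetry: `(g v) P = phase(P) · v (shift P)`.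
[cite: KhristoforovSmirnov2021, §2 Lemma 4, proof and Fig. 3 (arXiv v1 p. 4)] -/
noncomputable def picMonomial {σ : Equiv.Perm (Fin nm)} (hσ : IsCyc σ) : (Pic nm → ℂ) →ₗ[ℂ] (Pic nm → ℂ) where
  toFun v P := Pic.shiftPhase hσ P * v (Pic.shift hσ P)
  map_add' v v' := by funext P; simp only [Pi.add_apply]; ring
  map_smul' c v := by funext P; simp only [Pi.smul_apply, smul_eq_mul, RingHom.id_apply]; ring

/-- ★ the relation map intertwines: `Φ ∘ (· ∘ σ) = g ∘ Φ`. [cite: KhristoforovSmirnov2021, §2 Lemma 4, proof and Fig. 3 (arXiv v1 p. 4)] -/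
theorem relMapΦ_comp_funLeft {σ : Equiv.Perm (Fin nm)} (hσ : IsCyc σ) :
    relMapΦ nm ∘ₗ LinearMap.funLeft ℂ ℂ (patMap σ hσ) = picMonomial hσ ∘ₗ relMapΦ nm := by
  apply LinearMap.ext
  intro w
  funext P
  exact relMapΦ_comp_patMap hσ w P

/-- ★★★ **THE CHARACTER OF THE ROTATION ON THE TRIPOD-LAW SOLUTION SPACE VANISHES OFF THE IDENTITY WHEN `3 ∤ k`**:
for `k` coprime to `3` and `k ∤ r`, `tr (rot^r | solW k) = 0` — so every eigenvalue `ζ_k^s` of the rotation occurs in `solW k` with the SAME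
multiplicity `#NCMatching (k+1) / k` (a free `ℂ[Z/k]`-module). Proof: the relation map `Φ` is an equivariant surjection `ℂ^Pat ↠ ℂ^Pic` with
kernel `solW k`, for the permutation action on patterns and a monomial action on pictures; neither has fixed points (a fixed pattern needs a fixed
partner, `rot^r j = j`; a fixed picture needs a fixed cube, `rot^{3r} x = x`, i.e. `k ∣ 3r`), so both traces vanish and the trace is additive.
[cite: KhristoforovSmirnov2021, §2 Lemma 4, proof and Fig. 3 (arXiv v1 p. 4); §1.2 (p. 2: marked points indexed cyclically)] -/
theorem trace_solWRot_pow_eq_zero (h3 : Nat.Coprime 3 nm) {r : ℕ} (hr : ¬ nm ∣ r) :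
    LinearMap.trace ℂ (solW nm) (solWRot nm (rot nm ^ r) (isCyc_rot_pow r)).toLinearMap = 0 := by
  classical
  set σ : Equiv.Perm (Fin nm) := rot nm ^ r with hσdef
  have hσ : IsCyc σ := isCyc_rot_pow r
  -- the ambient map and its trace
  set f : (Pat nm → ℂ) →ₗ[ℂ] (Pat nm → ℂ) := LinearMap.funLeft ℂ ℂ (patMap σ hσ) with hf
  have hf0 : LinearMap.trace ℂ (Pat nm → ℂ) f = 0 := by
    refine trace_eq_zero_of_monomial (patMap σ hσ) (fun _ => 1) (fun p hp => ?_) f (fun v p => by rw [hf, LinearMap.funLeft_apply, one_mul])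
    obtain ⟨x, hx⟩ := exists_fixed_of_patMap_eq hσ p hp
    exact hr ((rot_pow_apply_eq_self_iff r x).1 hx)
  -- the quotient map and its trace
  have hg0 : LinearMap.trace ℂ (Pic nm → ℂ) (picMonomial hσ) = 0 := by
    refine trace_eq_zero_of_monomial (Pic.shift hσ) (Pic.shiftPhase hσ) (fun P hP => ?_) (picMonomial hσ) (fun v P => rfl)
    obtain ⟨x, hx⟩ := exists_fixed_of_shift_eq hσ P hP
    exact rot_pow_cube_ne_self h3 hr x hx
  -- additivity along `0 → solW → ℂ^Pat → ℂ^Pic → 0`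
  have hadd := trace_eq_add_of_exact' f (solW nm).subtype (relMapΦ nm) (Submodule.injective_subtype _) relMapΦ_surjective
    (by rw [Submodule.range_subtype, ker_relMapΦ]) (solWRot nm σ hσ).toLinearMap (picMonomial hσ)
    (by apply LinearMap.ext; intro w; rfl) (relMapΦ_comp_funLeft hσ)
  rw [hf0, hg0, add_zero] at hadd
  exact hadd.symm

/-- ★★ **THE CHARACTER IN GENERAL (every `k`, every `r` with `k ∤ r`)**: `tr (rot^r | solW k) = − Σ_{P : shift P = P} phase(P)` — minus the sum
of the phases over the pictures FIXED by the re-ordered transport (for `3 ∤ k` there are none: `trace_solWRot_pow_eq_zero`; for `3 ∣ k` and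
`r ∈ {k/3, 2k/3}` they are the rotation-invariant «triangle» pictures — the lane's exact tables give `−(k/3)·C_{(k−3)/6}·τ^{±2}`, not typed here).
[cite: KhristoforovSmirnov2021, §2 Lemma 4, proof and Fig. 3 (arXiv v1 p. 4); §1.2 (p. 2: cyclic indexing)] -/
theorem trace_solWRot_pow_eq_neg_sum_fixed [DecidableEq (Pic nm)] {r : ℕ} (hr : ¬ nm ∣ r) :
    LinearMap.trace ℂ (solW nm) (solWRot nm (rot nm ^ r) (isCyc_rot_pow r)).toLinearMap =
      -∑ P ∈ Finset.univ.filter (fun P : Pic nm => Pic.shift (isCyc_rot_pow r) P = P), Pic.shiftPhase (isCyc_rot_pow r) P := by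
  classical
  set σ : Equiv.Perm (Fin nm) := rot nm ^ r with hσdef
  have hσ : IsCyc σ := isCyc_rot_pow r
  set f : (Pat nm → ℂ) →ₗ[ℂ] (Pat nm → ℂ) := LinearMap.funLeft ℂ ℂ (patMap σ hσ) with hf
  have hf0 : LinearMap.trace ℂ (Pat nm → ℂ) f = 0 := by
    refine trace_eq_zero_of_monomial (patMap σ hσ) (fun _ => 1) (fun p hp => ?_) f (fun v p => by rw [hf, LinearMap.funLeft_apply, one_mul])
    obtain ⟨x, hx⟩ := exists_fixed_of_patMap_eq hσ p hp
    exact hr ((rot_pow_apply_eq_self_iff r x).1 hx)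
  have hg : LinearMap.trace ℂ (Pic nm → ℂ) (picMonomial hσ) =
      ∑ P ∈ Finset.univ.filter (fun P : Pic nm => Pic.shift hσ P = P), Pic.shiftPhase hσ P :=
    trace_eq_sum_fixed_of_monomial (Pic.shift hσ) (Pic.shiftPhase hσ) (picMonomial hσ) (fun v P => rfl)
  have hadd := trace_eq_add_of_exact' f (solW nm).subtype (relMapΦ nm) (Submodule.injective_subtype _) relMapΦ_surjective
    (by rw [Submodule.range_subtype, ker_relMapΦ]) (solWRot nm σ hσ).toLinearMap (picMonomial hσ)
    (by apply LinearMap.ext; intro w; rfl) (relMapΦ_comp_funLeft hσ)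
  have key : LinearMap.trace ℂ (solW nm) (solWRot nm σ hσ).toLinearMap = -(LinearMap.trace ℂ (Pic nm → ℂ) (picMonomial hσ)) := by
    rw [hf0] at hadd
    linear_combination -hadd
  rw [key, hg]

/-- the same for the basic rotation `rot` itself (`k ≥ 2`, `3 ∤ k`). [cite: KhristoforovSmirnov2021, §2 Lemma 4 (arXiv v1 p. 4); §1.2 (p. 2)] -/
theorem trace_solWRot_eq_zero (h3 : Nat.Coprime 3 nm) (hk : 2 ≤ nm) :
    LinearMap.trace ℂ (solW nm) (solWRot nm (rot nm ^ 1) (isCyc_rot_pow 1)).toLinearMap = 0 :=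
  trace_solWRot_pow_eq_zero h3 (fun h => by have := Nat.le_of_dvd Nat.one_pos h; omega)

end Character

/-! ### Corollary: `k ∣ #NCMatching (k+1)` for `3 ∤ k` — arithmetic from the vanishing character -/

section Divisibility

variable {nm : ℕ}

/-- the rotation operators on `solW`, one for each power. [cite: KhristoforovSmirnov2021, §1.2 (arXiv v1 p. 2: cyclic indexing)] -/
noncomputable def rotOp (nm r : ℕ) : solW nm →ₗ[ℂ] solW nm := (solWRot nm (rot nm ^ r) (isCyc_rot_pow r)).toLinearMap

/-- the rotation operator evaluated. [cite: KhristoforovSmirnov2021, §1.2 (arXiv v1 p. 2)] -/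
theorem rotOp_apply (r : ℕ) (w : solW nm) (p : Pat nm) : (rotOp nm r w : Pat nm → ℂ) p = w.1 (patMap (rot nm ^ r) (isCyc_rot_pow r) p) := rfl

/-- transporting along a product is transporting twice. [cite: KhristoforovSmirnov2021, §1.2 (arXiv v1 p. 2)] -/
theorem patMap_mul {σ ρ : Equiv.Perm (Fin nm)} (hσ : IsCyc σ) (hρ : IsCyc ρ) (h : IsCyc (σ * ρ)) (p : Pat nm) :
    patMap (σ * ρ) h p = patMap σ hσ (patMap ρ hρ p) := by
  apply Subtype.ext
  refine Prod.ext rfl ?_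
  rw [patMap_val, patMap_val, patMap_val]
  show relMap (σ * ρ) p.1.2 = relMap σ (relMap ρ p.1.2)
  rw [Equiv.Perm.mul_def, relMap_trans]

/-- `rot^k = 1`. [cite: KhristoforovSmirnov2021, §1.2 (arXiv v1 p. 2: cyclic indexing)] -/
theorem rot_pow_self : rot nm ^ nm = 1 := by
  ext x
  rw [Equiv.Perm.one_apply]
  exact congrArg Fin.val ((rot_pow_apply_eq_self_iff nm x).2 (dvd_refl nm))

/-- transporting along the identity does nothing. [cite: KhristoforovSmirnov2021, §1.2 (arXiv v1 p. 2)] -/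
theorem patMap_one (h : IsCyc (1 : Equiv.Perm (Fin nm))) (p : Pat nm) : patMap 1 h p = p := by
  apply Subtype.ext
  refine Prod.ext rfl ?_
  rw [patMap_val]
  show relMap (Equiv.refl _) p.1.2 = p.1.2
  rw [relMap_refl]

/-- transporting depends on the permutation only (the cyclicity proof is irrelevant). [cite: KhristoforovSmirnov2021, §1.2 (arXiv v1 p. 2)] -/
theorem patMap_congr {σ ρ : Equiv.Perm (Fin nm)} (hσ : IsCyc σ) (hρ : IsCyc ρ) (e : σ = ρ) (p : Pat nm) : patMap σ hσ p = patMap ρ hρ p := by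
  subst e; rfl

/-- `R_{r+1} = R_1 ∘ R_r`. [cite: KhristoforovSmirnov2021, §1.2 (arXiv v1 p. 2)] -/
theorem rotOp_succ (r : ℕ) : rotOp nm (r + 1) = rotOp nm 1 ∘ₗ rotOp nm r := by
  apply LinearMap.ext
  intro w
  apply Subtype.ext
  funext p
  have e : patMap (rot nm ^ (r + 1)) (isCyc_rot_pow (r + 1)) p = patMap (rot nm ^ r) (isCyc_rot_pow r) (patMap (rot nm ^ 1) (isCyc_rot_pow 1) p) := by
    rw [← patMap_mul (isCyc_rot_pow r) (isCyc_rot_pow 1) ((pow_add (rot nm) r 1) ▸ isCyc_rot_pow (r + 1))]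
    exact patMap_congr _ _ (pow_add (rot nm) r 1) p
  rw [LinearMap.comp_apply, rotOp_apply, rotOp_apply, rotOp_apply, e]

/-- transporting along `rot^k` or `rot^0` does nothing. [cite: KhristoforovSmirnov2021, §1.2 (arXiv v1 p. 2)] -/
theorem patMap_rot_pow_self (p : Pat nm) : patMap (rot nm ^ nm) (isCyc_rot_pow nm) p = p := by
  rw [patMap_congr (isCyc_rot_pow nm) (rot_pow_self (nm := nm) ▸ isCyc_rot_pow nm) rot_pow_self p]
  exact patMap_one _ p

/-- Auxiliary. [cite: KhristoforovSmirnov2021, §1.2 (arXiv v1 p. 2)] -/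
theorem patMap_rot_pow_zero (p : Pat nm) : patMap (rot nm ^ 0) (isCyc_rot_pow 0) p = p := by
  rw [patMap_congr (isCyc_rot_pow 0) ((pow_zero (rot nm)) ▸ isCyc_rot_pow 0) (pow_zero (rot nm)) p]
  exact patMap_one _ p

/-- `R_k = R_0`. [cite: KhristoforovSmirnov2021, §1.2 (arXiv v1 p. 2)] -/
theorem rotOp_self_eq_zero' : rotOp nm nm = rotOp nm 0 := by
  apply LinearMap.ext
  intro w
  apply Subtype.ext
  funext p
  rw [rotOp_apply, rotOp_apply, patMap_rot_pow_self, patMap_rot_pow_zero]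

/-- `R_0 = id`. [cite: KhristoforovSmirnov2021, §1.2 (arXiv v1 p. 2)] -/
theorem rotOp_zero : rotOp nm 0 = LinearMap.id := by
  apply LinearMap.ext
  intro w
  apply Subtype.ext
  funext p
  rw [rotOp_apply, LinearMap.id_apply, patMap_rot_pow_zero]

variable (nm) in
/-- the AVERAGING operator `A = Σ_{r<k} R_r`. [cite: KhristoforovSmirnov2021, §1.2 (arXiv v1 p. 2: cyclic indexing)] -/
noncomputable def avgOp : solW nm →ₗ[ℂ] solW nm := ∑ r ∈ Finset.range nm, rotOp nm r

/-- `R_1 ∘ A = A` (a cyclic shift of the sum). [cite: KhristoforovSmirnov2021, §1.2 (arXiv v1 p. 2)] -/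
theorem rotOp_comp_avgOp (hk : 0 < nm) : rotOp nm 1 ∘ₗ avgOp nm = avgOp nm := by
  apply LinearMap.ext
  intro w
  unfold avgOp
  rw [LinearMap.comp_apply, LinearMap.sum_apply, map_sum]
  have e : ∑ r ∈ Finset.range nm, rotOp nm 1 (rotOp nm r w) = ∑ r ∈ Finset.range nm, rotOp nm (r + 1) w :=
    Finset.sum_congr rfl fun r _ => by rw [rotOp_succ r]; rfl
  rw [e]
  obtain ⟨n, rfl⟩ : ∃ n, nm = n + 1 := ⟨nm - 1, by omega⟩
  rw [Finset.sum_range_succ, Finset.sum_range_succ' (fun r => rotOp (n + 1) r w), rotOp_self_eq_zero']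

/-- every value of `A` is rotation invariant. [cite: KhristoforovSmirnov2021, §1.2 (arXiv v1 p. 2)] -/
theorem rotOp_avgOp_apply (hk : 0 < nm) (w : solW nm) : rotOp nm 1 (avgOp nm w) = avgOp nm w := by
  have := congrArg (fun f => f w) (rotOp_comp_avgOp hk)
  simpa only [LinearMap.comp_apply] using this

/-- on a rotation-invariant vector every `R_r` is the identity. [cite: KhristoforovSmirnov2021, §1.2 (arXiv v1 p. 2)] -/
theorem rotOp_apply_of_fixed {w : solW nm} (hw : rotOp nm 1 w = w) (r : ℕ) : rotOp nm r w = w := by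
  induction r with
  | zero => rw [rotOp_zero, LinearMap.id_apply]
  | succ r ih => rw [rotOp_succ, LinearMap.comp_apply, ih, hw]

/-- on a rotation-invariant vector `A` is multiplication by `k`. [cite: KhristoforovSmirnov2021, §1.2 (arXiv v1 p. 2)] -/
theorem avgOp_apply_of_fixed {w : solW nm} (hw : rotOp nm 1 w = w) : avgOp nm w = (nm : ℂ) • w := by
  unfold avgOp
  rw [LinearMap.sum_apply, Finset.sum_congr rfl fun r _ => rotOp_apply_of_fixed hw r, Finset.sum_const, Finset.card_range, Nat.cast_smul_eq_nsmul]

/-- `A ∘ A = k • A`. [cite: KhristoforovSmirnov2021, §1.2 (arXiv v1 p. 2)] -/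
theorem avgOp_comp_avgOp (hk : 0 < nm) : avgOp nm ∘ₗ avgOp nm = (nm : ℂ) • avgOp nm := by
  apply LinearMap.ext
  intro w
  rw [LinearMap.comp_apply, avgOp_apply_of_fixed (rotOp_avgOp_apply hk w), LinearMap.smul_apply]

variable (nm) in
/-- the normalised averaging operator `P = k⁻¹ • A` — the projection onto the rotation-invariant solutions.
[cite: KhristoforovSmirnov2021, §1.2 (arXiv v1 p. 2: cyclic indexing)] -/
noncomputable def avgProj : solW nm →ₗ[ℂ] solW nm := ((nm : ℂ)⁻¹) • avgOp nm

/-- `P` is idempotent. [cite: KhristoforovSmirnov2021, §1.2 (arXiv v1 p. 2)] -/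
theorem isIdempotentElem_avgProj (hk : 0 < nm) : IsIdempotentElem (avgProj nm) := by
  have hk' : (nm : ℂ) ≠ 0 := Nat.cast_ne_zero.2 (Nat.pos_iff_ne_zero.1 hk)
  show avgProj nm * avgProj nm = avgProj nm
  unfold avgProj
  rw [Module.End.mul_eq_comp, LinearMap.smul_comp, LinearMap.comp_smul, avgOp_comp_avgOp hk, smul_smul, smul_smul,
    mul_assoc, inv_mul_cancel₀ hk', mul_one]

/-- the trace of `A` is the dimension of the solution space: only `R_0 = id` contributes, by `trace_solWRot_pow_eq_zero`.
[cite: KhristoforovSmirnov2021, §2 Lemma 4 (arXiv v1 p. 4); §1.2 (p. 2)] -/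
theorem trace_avgOp (h3 : Nat.Coprime 3 nm) (hk : 0 < nm) : LinearMap.trace ℂ (solW nm) (avgOp nm) = Module.finrank ℂ (solW nm) := by
  unfold avgOp
  rw [map_sum]
  obtain ⟨n, rfl⟩ : ∃ n, nm = n + 1 := ⟨nm - 1, by omega⟩
  rw [Finset.sum_range_succ', rotOp_zero, LinearMap.trace_id, Finset.sum_eq_zero, zero_add]
  intro r hr
  rw [Finset.mem_range] at hr
  exact trace_solWRot_pow_eq_zero h3 (fun h => by have := Nat.le_of_dvd (Nat.succ_pos r) h; omega)

/-- ★★ **ARITHMETIC FROM THE CHARACTER**: for `3 ∤ k` (`k ≥ 1`) the dimension of the tripod-law solution space is `k` times the dimension of its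
rotation-invariant part — so `k ∣ dim solW k`. [cite: KhristoforovSmirnov2021, §2 Lemma 4 (arXiv v1 p. 4); §1.2 (p. 2: cyclic indexing)] -/
theorem finrank_solW_eq_mul_finrank_fixed (h3 : Nat.Coprime 3 nm) (hk : 0 < nm) :
    Module.finrank ℂ (solW nm) = nm * Module.finrank ℂ (LinearMap.range (avgProj nm)) := by
  have hk' : (nm : ℂ) ≠ 0 := Nat.cast_ne_zero.2 (Nat.pos_iff_ne_zero.1 hk)
  have hP : LinearMap.IsProj (LinearMap.range (avgProj nm)) (avgProj nm) :=
    (LinearMap.isProj_range_iff_isIdempotentElem _).2 (isIdempotentElem_avgProj hk)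
  haveI : Module.Free ℂ (LinearMap.range (avgProj nm)) := @Module.Free.of_divisionRing ℂ (LinearMap.range (avgProj nm)) _ _ _
  haveI : Module.Free ℂ (LinearMap.ker (avgProj nm)) := @Module.Free.of_divisionRing ℂ (LinearMap.ker (avgProj nm)) _ _ _
  have htr : LinearMap.trace ℂ (solW nm) (avgProj nm) = (Module.finrank ℂ (LinearMap.range (avgProj nm)) : ℂ) := hP.trace
  have h2 : LinearMap.trace ℂ (solW nm) (avgProj nm) = (nm : ℂ)⁻¹ * (Module.finrank ℂ (solW nm) : ℂ) := by
    unfold avgProj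
    rw [map_smul, smul_eq_mul, trace_avgOp h3 hk]
  have key : (Module.finrank ℂ (solW nm) : ℂ) = (nm : ℂ) * (Module.finrank ℂ (LinearMap.range (avgProj nm)) : ℂ) := by
    rw [← htr, h2, ← mul_assoc, mul_inv_cancel₀ hk', one_mul]
  exact_mod_cast key

/-- ★★ hence **`k` DIVIDES THE NUMBER OF NON-CROSSING PERFECT MATCHINGS OF `k + 1` POINTS whenever `3 ∤ k`** (`k ≥ 1`) — obtained here from the
representation theory of the tripod law, not from the Catalan closed form (consistent with it: for odd `k = 2n−1`, `gcd(2n−1, n+1) ∣ 3`).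
[cite: KhristoforovSmirnov2021, §1.2 (arXiv v1 p. 2: the link pattern); §2 Lemma 4 (p. 4)] -/
theorem dvd_card_ncMatching (h3 : Nat.Coprime 3 nm) (hk : 0 < nm) : nm ∣ Fintype.card (NCMatching (nm + 1)) := by
  rw [← finrank_solW_eq_card_ncMatching, finrank_solW_eq_mul_finrank_fixed h3 hk]
  exact Dvd.intro _ rfl

end Divisibility

/-! ### Every `k`-th root of unity has the same multiplicity: the twisted averaging projectors -/

section Isotypic

variable {nm : ℕ}

variable (nm) in
/-- the TWISTED averaging operator `A_ζ = Σ_{r<k} ζ^{-r} R_r` for a `k`-th root of unity `ζ`. [cite: KhristoforovSmirnov2021, §1.2 (arXiv v1 p. 2: cyclic indexing)] -/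
noncomputable def twAvgOp (ζ : ℂ) : solW nm →ₗ[ℂ] solW nm := ∑ r ∈ Finset.range nm, (ζ⁻¹) ^ r • rotOp nm r

/-- a `k`-th root of unity is non-zero (`k ≥ 1`). [folklore-free restatement] [cite: KhristoforovSmirnov2021, §1.2 (arXiv v1 p. 2)] -/
private theorem ne_zero_of_pow_eq_one {ζ : ℂ} (hk : 0 < nm) (hζ : ζ ^ nm = 1) : ζ ≠ 0 := by
  rintro rfl
  rw [zero_pow (Nat.pos_iff_ne_zero.1 hk)] at hζ
  exact zero_ne_one hζ

/-- `R_1 ∘ A_ζ = ζ • A_ζ` (a cyclic shift of the twisted sum), on elements. [cite: KhristoforovSmirnov2021, §1.2 (arXiv v1 p. 2)] -/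
theorem rotOp_twAvgOp_apply {ζ : ℂ} (hk : 0 < nm) (hζ : ζ ^ nm = 1) (w : solW nm) : rotOp nm 1 (twAvgOp nm ζ w) = ζ • twAvgOp nm ζ w := by
  have hζ0 : ζ ≠ 0 := ne_zero_of_pow_eq_one hk hζ
  unfold twAvgOp
  rw [LinearMap.sum_apply, map_sum, Finset.smul_sum]
  -- both sides as sums of `c_r • R_r w`
  have eL : ∑ r ∈ Finset.range nm, rotOp nm 1 (((ζ⁻¹) ^ r • rotOp nm r) w) = ∑ r ∈ Finset.range nm, (ζ⁻¹) ^ r • rotOp nm (r + 1) w := by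
    refine Finset.sum_congr rfl fun r _ => ?_
    rw [LinearMap.smul_apply, map_smul, rotOp_succ r, LinearMap.comp_apply]
  have eR : ∑ r ∈ Finset.range nm, ζ • (((ζ⁻¹) ^ r • rotOp nm r) w) = ∑ r ∈ Finset.range nm, (ζ * (ζ⁻¹) ^ r) • rotOp nm r w := by
    refine Finset.sum_congr rfl fun r _ => ?_
    rw [LinearMap.smul_apply, smul_smul]
  rw [eL, eR]
  obtain ⟨n, rfl⟩ : ∃ n, nm = n + 1 := ⟨nm - 1, by omega⟩
  rw [Finset.sum_range_succ, Finset.sum_range_succ' (fun r => (ζ * (ζ⁻¹) ^ r) • (rotOp (n + 1) r) w), rotOp_self_eq_zero']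
  have hc : ∀ r : ℕ, ζ * (ζ⁻¹) ^ (r + 1) = (ζ⁻¹) ^ r := fun r => by
    rw [pow_succ, mul_comm ((ζ⁻¹) ^ r), ← mul_assoc, mul_inv_cancel₀ hζ0, one_mul]
  have hn : (ζ⁻¹) ^ n = ζ * (ζ⁻¹) ^ 0 := by
    rw [pow_zero, mul_one]
    have h1 : (ζ⁻¹) ^ (n + 1) = 1 := by rw [inv_pow, hζ, inv_one]
    have h2 : ζ * (ζ⁻¹) ^ (n + 1) = (ζ⁻¹) ^ n := hc n
    rw [h1, mul_one] at h2
    exact h2.symm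
  simp only [hc]
  rw [hn]

/-- on a `ζ`-eigenvector of the rotation every `R_r` acts by `ζ^r`. [cite: KhristoforovSmirnov2021, §1.2 (arXiv v1 p. 2)] -/
theorem rotOp_apply_of_eigen {ζ : ℂ} {w : solW nm} (hw : rotOp nm 1 w = ζ • w) (r : ℕ) : rotOp nm r w = ζ ^ r • w := by
  induction r with
  | zero => rw [rotOp_zero, LinearMap.id_apply, pow_zero, one_smul]
  | succ r ih => rw [rotOp_succ, LinearMap.comp_apply, ih, map_smul, hw, smul_smul, pow_succ, mul_comm]

/-- on a `ζ`-eigenvector `A_ζ` is multiplication by `k`. [cite: KhristoforovSmirnov2021, §1.2 (arXiv v1 p. 2)] -/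
theorem twAvgOp_apply_of_eigen {ζ : ℂ} (hk : 0 < nm) (hζ : ζ ^ nm = 1) {w : solW nm} (hw : rotOp nm 1 w = ζ • w) :
    twAvgOp nm ζ w = (nm : ℂ) • w := by
  have hζ0 : ζ ≠ 0 := ne_zero_of_pow_eq_one hk hζ
  unfold twAvgOp
  rw [LinearMap.sum_apply]
  have e : ∑ r ∈ Finset.range nm, ((ζ⁻¹) ^ r • rotOp nm r) w = ∑ r ∈ Finset.range nm, w := by
    refine Finset.sum_congr rfl fun r _ => ?_
    rw [LinearMap.smul_apply, rotOp_apply_of_eigen hw r, smul_smul, ← mul_pow, inv_mul_cancel₀ hζ0, one_pow, one_smul]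
  rw [e, Finset.sum_const, Finset.card_range, Nat.cast_smul_eq_nsmul]

/-- `A_ζ ∘ A_ζ = k • A_ζ`. [cite: KhristoforovSmirnov2021, §1.2 (arXiv v1 p. 2)] -/
theorem twAvgOp_comp_twAvgOp {ζ : ℂ} (hk : 0 < nm) (hζ : ζ ^ nm = 1) : twAvgOp nm ζ ∘ₗ twAvgOp nm ζ = (nm : ℂ) • twAvgOp nm ζ := by
  apply LinearMap.ext
  intro w
  rw [LinearMap.comp_apply, twAvgOp_apply_of_eigen hk hζ (rotOp_twAvgOp_apply hk hζ w), LinearMap.smul_apply]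

variable (nm) in
/-- the normalised twisted projector `P_ζ = k⁻¹ • A_ζ` — the projection onto the `ζ`-eigenspace of the rotation.
[cite: KhristoforovSmirnov2021, §1.2 (arXiv v1 p. 2: cyclic indexing)] -/
noncomputable def twProj (ζ : ℂ) : solW nm →ₗ[ℂ] solW nm := ((nm : ℂ)⁻¹) • twAvgOp nm ζ

/-- `P_ζ` is idempotent. [cite: KhristoforovSmirnov2021, §1.2 (arXiv v1 p. 2)] -/
theorem isIdempotentElem_twProj {ζ : ℂ} (hk : 0 < nm) (hζ : ζ ^ nm = 1) : IsIdempotentElem (twProj nm ζ) := by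
  have hk' : (nm : ℂ) ≠ 0 := Nat.cast_ne_zero.2 (Nat.pos_iff_ne_zero.1 hk)
  show twProj nm ζ * twProj nm ζ = twProj nm ζ
  unfold twProj
  rw [Module.End.mul_eq_comp, LinearMap.smul_comp, LinearMap.comp_smul, twAvgOp_comp_twAvgOp hk hζ, smul_smul, smul_smul,
    mul_assoc, inv_mul_cancel₀ hk', mul_one]

/-- ★ **the range of `P_ζ` IS the `ζ`-eigenspace of the rotation.** [cite: KhristoforovSmirnov2021, §1.2 (arXiv v1 p. 2)] -/
theorem mem_range_twProj_iff {ζ : ℂ} (hk : 0 < nm) (hζ : ζ ^ nm = 1) (w : solW nm) :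
    w ∈ LinearMap.range (twProj nm ζ) ↔ rotOp nm 1 w = ζ • w := by
  have hk' : (nm : ℂ) ≠ 0 := Nat.cast_ne_zero.2 (Nat.pos_iff_ne_zero.1 hk)
  constructor
  · rintro ⟨u, rfl⟩
    unfold twProj
    rw [LinearMap.smul_apply, map_smul, rotOp_twAvgOp_apply hk hζ u, smul_comm]
  · intro hw
    refine ⟨w, ?_⟩
    unfold twProj
    rw [LinearMap.smul_apply, twAvgOp_apply_of_eigen hk hζ hw, smul_smul, inv_mul_cancel₀ hk', one_smul]

/-- the trace of `A_ζ` is the dimension of the solution space when `3 ∤ k` (only `R_0 = id` contributes).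
[cite: KhristoforovSmirnov2021, §2 Lemma 4 (arXiv v1 p. 4); §1.2 (p. 2)] -/
theorem trace_twAvgOp (h3 : Nat.Coprime 3 nm) (hk : 0 < nm) (ζ : ℂ) : LinearMap.trace ℂ (solW nm) (twAvgOp nm ζ) = Module.finrank ℂ (solW nm) := by
  unfold twAvgOp
  rw [map_sum]
  obtain ⟨n, rfl⟩ : ∃ n, nm = n + 1 := ⟨nm - 1, by omega⟩
  rw [Finset.sum_range_succ', pow_zero, one_smul, rotOp_zero, LinearMap.trace_id, Finset.sum_eq_zero, zero_add]
  intro r hr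
  rw [Finset.mem_range] at hr
  have h0 : LinearMap.trace ℂ (solW (n + 1)) (rotOp (n + 1) (r + 1)) = 0 :=
    trace_solWRot_pow_eq_zero h3 (fun h => by have := Nat.le_of_dvd (Nat.succ_pos r) h; omega)
  rw [map_smul, h0, smul_zero]

/-- ★★★ **FREENESS, IN FULL**: for `3 ∤ k` (`k ≥ 1`) and EVERY `k`-th root of unity `ζ`, the `ζ`-eigenspace of the rotation on the tripod-law solution
space has dimension exactly `dim solW k / k`: `dim solW k = k · dim {w : rot·w = ζ w}` — every character of `Z/k` occurs with the same multiplicity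
(`#NCMatching (k+1) / k`; the lane's tables: 1, 2, 12, 33 for k = 5, 7, 11, 13). [cite: KhristoforovSmirnov2021, §2 Lemma 4 (arXiv v1 p. 4); §1.2 (p. 2: cyclic indexing)] -/
theorem finrank_solW_eq_mul_finrank_eigenspace (h3 : Nat.Coprime 3 nm) (hk : 0 < nm) {ζ : ℂ} (hζ : ζ ^ nm = 1) :
    Module.finrank ℂ (solW nm) = nm * Module.finrank ℂ (LinearMap.range (twProj nm ζ)) := by
  have hk' : (nm : ℂ) ≠ 0 := Nat.cast_ne_zero.2 (Nat.pos_iff_ne_zero.1 hk)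
  have hP : LinearMap.IsProj (LinearMap.range (twProj nm ζ)) (twProj nm ζ) :=
    (LinearMap.isProj_range_iff_isIdempotentElem _).2 (isIdempotentElem_twProj hk hζ)
  haveI : Module.Free ℂ (LinearMap.range (twProj nm ζ)) := @Module.Free.of_divisionRing ℂ (LinearMap.range (twProj nm ζ)) _ _ _
  haveI : Module.Free ℂ (LinearMap.ker (twProj nm ζ)) := @Module.Free.of_divisionRing ℂ (LinearMap.ker (twProj nm ζ)) _ _ _
  have htr : LinearMap.trace ℂ (solW nm) (twProj nm ζ) = (Module.finrank ℂ (LinearMap.range (twProj nm ζ)) : ℂ) := hP.trace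
  have h2 : LinearMap.trace ℂ (solW nm) (twProj nm ζ) = (nm : ℂ)⁻¹ * (Module.finrank ℂ (solW nm) : ℂ) := by
    unfold twProj
    rw [map_smul, smul_eq_mul, trace_twAvgOp h3 hk]
  have key : (Module.finrank ℂ (solW nm) : ℂ) = (nm : ℂ) * (Module.finrank ℂ (LinearMap.range (twProj nm ζ)) : ℂ) := by
    rw [← htr, h2, ← mul_assoc, mul_inv_cancel₀ hk', one_mul]
  exact_mod_cast key

end Isotypic

/-! ### `3 ∣ k`: the fixed pictures of the order-3 rotation are the invariant triangles, all with the same phase -/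

section OrderThree

variable {nm : ℕ}

/-- the value of `rot^r x` without wrap-around bookkeeping: either `x + r` or `x + r − k` (`r < k`).
[cite: KhristoforovSmirnov2021, §1.2 (arXiv v1 p. 2: cyclic indexing)] -/
theorem val_rot_pow_or {r : ℕ} (hr : r < nm) (x : Fin nm) :
    (((rot nm ^ r) x : Fin nm) : ℕ) = x.val + r ∨ (((rot nm ^ r) x : Fin nm) : ℕ) + nm = x.val + r := by
  rw [val_rot_pow]
  have hx := x.2
  by_cases h : x.val + r < nm
  · left; exact Nat.mod_eq_of_lt h
  · right
    have e : x.val + r = (x.val + r - nm) + nm * 1 := by omega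
    rw [e, Nat.add_mul_mod_self_left, Nat.mod_eq_of_lt (by omega)]
    omega

/-- ★ **for `k = 3r` the pictures fixed by the re-ordered transport along `rot^r` are exactly the INVARIANT TRIANGLES** `(α, α + r, α + 2r; L₀)` with
`rot^r L₀ = L₀`. [cite: KhristoforovSmirnov2021, §1.2 (arXiv v1 p. 2: cyclic indexing); §2 Lemma 4, Fig. 3 (p. 4)] -/
theorem shift_eq_self_iff_of_three_mul {r : ℕ} (hr : 3 * r = nm) (hpos : 0 < r) (P : Pic nm) :
    Pic.shift (isCyc_rot_pow r) P = P ↔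
      (P.β.val = P.α.val + r ∧ P.γ.val = P.α.val + 2 * r ∧ relMap (rot nm ^ r) P.L₀ = P.L₀) := by
  have hrk : r < nm := by omega
  have hα := val_rot_pow_or hrk P.α
  have hβ := val_rot_pow_or hrk P.β
  have hγ := val_rot_pow_or hrk P.γ
  have l1 := P.lt₁; have l2 := P.lt₂
  have bα := P.α.2; have bβ := P.β.2; have bγ := P.γ.2
  rw [Fin.lt_def] at l1 l2
  constructor
  · intro h
    unfold Pic.shift at h
    by_cases h1 : (rot nm ^ r) P.α < (rot nm ^ r) P.β ∧ (rot nm ^ r) P.β < (rot nm ^ r) P.γ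
    · rw [dif_pos h1] at h
      have e : (rot nm ^ r) P.α = P.α := congrArg Pic.α h
      exact absurd ((rot_pow_apply_eq_self_iff r P.α).1 e) (fun hd => by have := Nat.le_of_dvd hpos hd; omega)
    · rw [dif_neg h1] at h
      by_cases h2 : (rot nm ^ r) P.β < (rot nm ^ r) P.γ ∧ (rot nm ^ r) P.γ < (rot nm ^ r) P.α
      · rw [dif_pos h2] at h
        have e1 := congrArg Fin.val (congrArg Pic.α h)   -- rot β = α
        have e2 := congrArg Fin.val (congrArg Pic.β h)   -- rot γ = β
        have e3 := congrArg Fin.val (congrArg Pic.γ h)   -- rot α = γ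
        change (((rot nm ^ r) P.β : Fin nm) : ℕ) = P.α.val at e1
        change (((rot nm ^ r) P.γ : Fin nm) : ℕ) = P.β.val at e2
        change (((rot nm ^ r) P.α : Fin nm) : ℕ) = P.γ.val at e3
        exfalso; omega
      · rw [dif_neg h2] at h
        have e1 := congrArg Fin.val (congrArg Pic.α h)   -- rot γ = α
        have e2 := congrArg Fin.val (congrArg Pic.β h)   -- rot α = β
        have e3 := congrArg Fin.val (congrArg Pic.γ h)   -- rot β = γ
        have e4 : relMap (rot nm ^ r) P.L₀ = P.L₀ := congrArg Pic.L₀ h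
        change (((rot nm ^ r) P.γ : Fin nm) : ℕ) = P.α.val at e1
        change (((rot nm ^ r) P.α : Fin nm) : ℕ) = P.β.val at e2
        change (((rot nm ^ r) P.β : Fin nm) : ℕ) = P.γ.val at e3
        refine ⟨by omega, by omega, e4⟩
  · rintro ⟨hb, hc, hL⟩
    -- the three images: `rot α = β`, `rot β = γ`, `rot γ = α`
    have eα : (rot nm ^ r) P.α = P.β := Fin.ext (by rcases hα with h | h <;> omega)
    have eβ : (rot nm ^ r) P.β = P.γ := Fin.ext (by rcases hβ with h | h <;> omega)
    have eγ : (rot nm ^ r) P.γ = P.α := Fin.ext (by rcases hγ with h | h <;> omega)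
    unfold Pic.shift
    have n1 : ¬ ((rot nm ^ r) P.α < (rot nm ^ r) P.β ∧ (rot nm ^ r) P.β < (rot nm ^ r) P.γ) := by
      rw [eα, eβ, eγ, Fin.lt_def, Fin.lt_def]; omega
    have n2 : ¬ ((rot nm ^ r) P.β < (rot nm ^ r) P.γ ∧ (rot nm ^ r) P.γ < (rot nm ^ r) P.α) := by
      rw [eα, eβ, eγ, Fin.lt_def, Fin.lt_def]; omega
    rw [dif_neg n1, dif_neg n2]
    -- the third case rebuilds `P` itself
    obtain ⟨⟨⟨a, b, c⟩, L⟩, hP⟩ := P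
    simp only [Pic.α, Pic.β, Pic.γ, Pic.L₀] at eα eβ eγ hL ⊢
    subst eα; subst eβ
    apply Subtype.ext
    simp only [hL, eγ]

/-- ★ … and on them the phase is `τ²`. [cite: KhristoforovSmirnov2021, §2 Lemma 4, proof and Fig. 3 (arXiv v1 p. 4)] -/
theorem shiftPhase_eq_of_fixed {r : ℕ} (hr : 3 * r = nm) (hpos : 0 < r) (P : Pic nm) (h : Pic.shift (isCyc_rot_pow r) P = P) :
    Pic.shiftPhase (isCyc_rot_pow r) P = tau ^ 2 := by
  have hrk : r < nm := by omega
  obtain ⟨hb, hc, -⟩ := (shift_eq_self_iff_of_three_mul hr hpos P).1 h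
  have hα := val_rot_pow_or hrk P.α
  have hβ := val_rot_pow_or hrk P.β
  have hγ := val_rot_pow_or hrk P.γ
  have bα := P.α.2; have bβ := P.β.2; have bγ := P.γ.2
  have eα : (rot nm ^ r) P.α = P.β := Fin.ext (by rcases hα with h | h <;> omega)
  have eβ : (rot nm ^ r) P.β = P.γ := Fin.ext (by rcases hβ with h | h <;> omega)
  have eγ : (rot nm ^ r) P.γ = P.α := Fin.ext (by rcases hγ with h | h <;> omega)
  have l1 := P.lt₁; have l2 := P.lt₂
  rw [Fin.lt_def] at l1 l2
  unfold Pic.shiftPhase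
  rw [eα, eβ, eγ, if_neg (by rw [Fin.lt_def, Fin.lt_def]; omega), if_neg (by rw [Fin.lt_def, Fin.lt_def]; omega)]

/-- ★★ **THE CHARACTER AT THE ORDER-3 ROTATION (`k = 3r`)**: `tr (rot^r | solW k) = −τ² · N` with `N` the NUMBER of invariant triangle pictures
`(α, α + r, α + 2r; L₀)`, `rot^r L₀ = L₀` — a non-positive-real multiple of `τ²` (the lane's exact tables: `N = (k/3)·C_{(k−3)/6}` = 1, 3, 10 for
k = 3, 9, 15; the count itself is not evaluated here). [cite: KhristoforovSmirnov2021, §2 Lemma 4, proof and Fig. 3 (arXiv v1 p. 4); §1.2 (p. 2)] -/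
theorem trace_solWRot_third_eq [DecidableEq (Pic nm)] {r : ℕ} (hr : 3 * r = nm) (hpos : 0 < r) :
    LinearMap.trace ℂ (solW nm) (solWRot nm (rot nm ^ r) (isCyc_rot_pow r)).toLinearMap =
      -(tau ^ 2 * ((Finset.univ.filter fun P : Pic nm => Pic.shift (isCyc_rot_pow r) P = P).card : ℂ)) := by
  have hnd : ¬ nm ∣ r := fun hd => by have := Nat.le_of_dvd hpos hd; omega
  rw [trace_solWRot_pow_eq_neg_sum_fixed hnd, Finset.sum_congr rfl fun P hP => shiftPhase_eq_of_fixed hr hpos P (Finset.mem_filter.1 hP).2,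
    Finset.sum_const, nsmul_eq_mul, mul_comm]

end OrderThree

end Literature.Probability.Percolation.MarkedLoops

/-! ## The holomorphicity defect of ANY class weight factors through the relation map -/

namespace Literature.Probability.Percolation.MarkedLoops

open Literature.Probability.Percolation Literature.Probability.LatticeModels
open Literature.Probability.Percolation.FivePoint (tau)
open TriMarkedDomain

section Defect

variable {nm : ℕ} (D : TriMarkedDomain nm)

/-- **the HOLOMORPHICITY DEFECT** of a pattern weight at a face: `Σ_{i : Fin 3} τ^i ObsW D (classWt w) v i`, as a LINEAR functional of `w`
(the one-car's `obsWLin`, `classWtLin`). [cite: KhristoforovSmirnov2021, §2 Lemma 4 eq. (3) (arXiv v1 p. 4)] -/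
noncomputable def holoDefect (v : HexVertex) : (Pat nm → ℂ) →ₗ[ℂ] ℂ :=
  ∑ i : Fin 3, tau ^ (i : ℕ) • (obsWLin D v i ∘ₗ classWtLin nm)

/-- the defect evaluated. [cite: KhristoforovSmirnov2021, §2 Lemma 4 eq. (3) (arXiv v1 p. 4)] -/
theorem holoDefect_apply (v : HexVertex) (w : Pat nm → ℂ) : holoDefect D v w = ∑ i : Fin 3, tau ^ (i : ℕ) * ObsW D (classWt w) v i := by
  unfold holoDefect
  rw [LinearMap.sum_apply]
  refine Finset.sum_congr rfl fun i _ => ?_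
  rw [LinearMap.smul_apply, LinearMap.comp_apply, classWtLin_apply, obsWLin_apply, smul_eq_mul]

variable {D}

/-- the defect vanishes on the solution space (HOLO-K: the tripod law implies discrete holomorphicity).
[cite: KhristoforovSmirnov2021, §2 Lemma 4 eq. (3) (arXiv v1 p. 4)] -/
theorem holoDefect_eq_zero_of_mem_solW {v : HexVertex} (hv : AllSides D v) {w : Pat nm → ℂ} (hw : w ∈ solW nm) : holoDefect D v w = 0 := by
  rw [holoDefect_apply]
  exact holomorphicW_classWt D hw v hv

/-- ★★ **THE HOLOMORPHICITY DEFECT OF ANY CLASS WEIGHT IS A LINEAR FUNCTION OF ITS TRIPOD-RELATION VALUES**: at every face with three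
`H_G`-sides of every `k`-marked domain there is a linear functional `λ` on `ℂ^{Pic k}` with `Σ_i τ^i ObsW D (classWt w) v i = λ (Φ w)` for ALL
pattern weights `w` — the tripod relations are the only linear source of holomorphicity (HOLO-K is the case `Φ w = 0`). Proof: the defect kills
`ker Φ = solW` and `Φ` is onto. (Necessity — joint injectivity of the `λ`'s over all domains — is NOT claimed.)
[cite: KhristoforovSmirnov2021, §2 Lemma 4, proof and Fig. 3 (arXiv v1 p. 4: «each triple contributes zero»)] -/
theorem holoDefect_factors {v : HexVertex} (hv : AllSides D v) :
    ∃ lam : (Pic nm → ℂ) →ₗ[ℂ] ℂ, ∀ w : Pat nm → ℂ, (∑ i : Fin 3, tau ^ (i : ℕ) * ObsW D (classWt w) v i) = lam (relMapΦ nm w) := by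
  have hker : LinearMap.ker (relMapΦ nm) ≤ LinearMap.ker (holoDefect D v) := by
    intro w hw
    rw [ker_relMapΦ] at hw
    exact (LinearMap.mem_ker).2 (holoDefect_eq_zero_of_mem_solW hv hw)
  refine ⟨(LinearMap.ker (relMapΦ nm)).liftQ (holoDefect D v) hker ∘ₗ ((relMapΦ nm).quotKerEquivOfSurjective relMapΦ_surjective).symm.toLinearMap,
    fun w => ?_⟩
  rw [← holoDefect_apply, LinearMap.comp_apply, LinearEquiv.coe_toLinearMap, LinearMap.quotKerEquivOfSurjective_symm_apply, Submodule.liftQ_apply]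

end Defect

end Literature.Probability.Percolation.MarkedLoops
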